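import Mathlib
import Summits.Ventures.PercRepro2.CoinKSureLayer
import Summits.Ventures.PercRepro2.CoinKSureAD
import Summits.Ventures.PercRepro2.CoinChainScStates
import Summits.Ventures.PercRepro2.CoinChainScLevels

/-!
# The τ-layer-cake bound for an OR-tail pair (blind cell PercRepro2, night-2 g26;
proofs/NIGHT2-DARC.md §66–67)

For an abstract OR-tail pair `(G, G')` on `U.powerset` with entry set `ent` (as in
`gate_functional_nonneg`: `G` the `R`-law, `G'` the gate, the gate log-supermodular and
Holley-above the `R`-law from every entered cluster — the identity on the ideal is not needed), the
cleared gate functional `∑ G' (Λx − Λ₁)(Λy − Λ₂)` dominates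
`(Λ₂ − Λ Ȳ_∅) · ∑ (G − G')(Λx − Λ₁)`, `Ȳ_∅` the gate's `y`-mean on the ideal state
`{W ∩ ent = ∅}`.  In cleared form with `N_∅ = ∑_{W ∩ ent = ∅} G'` and
`N_∅ʸ = ∑_{W ∩ ent = ∅} G' y` (`tau_layer_bound`):

  `(Λ₂ N_∅ − Λ N_∅ʸ) · ∑ (G − G')(Λx − Λ₁) ≤ N_∅ · ∑ G' (Λx − Λ₁)(Λy − Λ₂)`.

Proof.  Decompose by entry states `e = W ∩ ent`; within a state the gate is log-supermodular, so
`∑_{W ∈ e} G' X̃ Ỹ ≥ N_e (ΛX̄_e − Λ₁)(ΛȲ_e − Λ₂)` (`fiber_cov`).  Write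
`ΛȲ_e − Λ₂ = (ΛȲ_e − ΛȲ_∅) + (ΛȲ_∅ − Λ₂)`: the sum with the first factor is a layer cake over
the `y`-shift relative to the ideal state — nonnegative on the support (`fiber_holley`), whose
level sets are up-sets of entered states with nonnegative `x`-level sums (`level_sum_eq`,
`level_holley`) — hence `≥ 0` (`sum_mul_nonneg_of_levels`); the sum with the second factor is
`(ΛȲ_∅ − Λ₂) ∑_e N_e (ΛX̄_e − Λ₁)` and `∑_e N_e (ΛX̄_e − Λ₁) = ∑ G' (Λx − Λ₁) = −∑ (G − G')(Λx − Λ₁)`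
(the `R`-law is centred).  The lemma needs no log-supermodularity of the `R`-law.
-/

namespace Summit.Ventures.PercRepro2.Coin

open Classical

section TauLayer

variable {V : Type*} [DecidableEq V] {R : Type*} [Field R] [LinearOrder R] [IsStrictOrderedRing R]

/-- **THE τ-LAYER-CAKE BOUND.** For an OR-tail pair `(G, G')` with entry set `ent`:
`(Λ₂ N_∅ − Λ N_∅ʸ) · ∑ (G − G')(Λx − Λ₁) ≤ N_∅ · ∑ G' (Λx − Λ₁)(Λy − Λ₂)`. -/
theorem tau_layer_bound (U ent : Finset V) (G G' x y : Finset V → R)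
    (hG : ∀ W, 0 ≤ G W) (hG' : ∀ W, 0 ≤ G' W)
    (hx0 : ∀ W, 0 ≤ x W) (hy0 : ∀ W, 0 ≤ y W)
    (hxm : ∀ s t, x s ≤ x (s ∪ t)) (hym : ∀ s t, y s ≤ y (s ∪ t))
    (wMM : ∀ s ⊆ U, ∀ t ⊆ U, G' s * G' t ≤ G' (s ∩ t) * G' (s ∪ t))
    (wML : ∀ s ⊆ U, ∀ t ⊆ U, (∃ r ∈ ent, r ∈ s) → G' s * G t ≤ G (s ∩ t) * G' (s ∪ t)) :
    ((∑ W ∈ U.powerset, G W * y W) * (∑ W ∈ U.powerset.filter (fun W => W ∩ ent = ∅), G' W)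
        - (∑ W ∈ U.powerset, G W) *
          (∑ W ∈ U.powerset.filter (fun W => W ∩ ent = ∅), G' W * y W)) *
      (∑ W ∈ U.powerset, (G W - G' W) *
        ((∑ W ∈ U.powerset, G W) * x W - (∑ W ∈ U.powerset, G W * x W))) ≤
    (∑ W ∈ U.powerset.filter (fun W => W ∩ ent = ∅), G' W) *
      (∑ W ∈ U.powerset, G' W *
        (((∑ W ∈ U.powerset, G W) * x W - (∑ W ∈ U.powerset, G W * x W)) *
          ((∑ W ∈ U.powerset, G W) * y W - (∑ W ∈ U.powerset, G W * y W)))) := by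
  -- the `R`-law totals
  set Λ := ∑ W ∈ U.powerset, G W with hΛ
  set Λ₁ := ∑ W ∈ U.powerset, G W * x W with hΛ₁
  set Λ₂ := ∑ W ∈ U.powerset, G W * y W with hΛ₂
  have hΛ0 : 0 ≤ Λ := Finset.sum_nonneg fun W _ => hG W
  -- the `R`-law is centred: `∑ G (Λx − Λ₁) = 0`
  have hcentred : (∑ W ∈ U.powerset, G W * (Λ * x W - Λ₁)) = 0 := by
    have : (∑ W ∈ U.powerset, G W * (Λ * x W - Λ₁)) =
        Λ * (∑ W ∈ U.powerset, G W * x W) - Λ₁ * (∑ W ∈ U.powerset, G W) := by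
      rw [Finset.mul_sum, Finset.mul_sum, ← Finset.sum_sub_distrib]
      exact Finset.sum_congr rfl fun W _ => by ring
    rw [this, ← hΛ, ← hΛ₁]; ring
  clear_value Λ Λ₁ Λ₂
  -- state masses and moments of the gate
  set N : Finset V → R := fun e => ∑ W ∈ U.powerset.filter (fun W => W ∩ ent = e), G' W with hN
  set Nx : Finset V → R :=
    fun e => ∑ W ∈ U.powerset.filter (fun W => W ∩ ent = e), G' W * x W with hNx
  set Ny : Finset V → R :=
    fun e => ∑ W ∈ U.powerset.filter (fun W => W ∩ ent = e), G' W * y W with hNy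
  set Nxy : Finset V → R :=
    fun e => ∑ W ∈ U.powerset.filter (fun W => W ∩ ent = e), G' W * (x W * y W) with hNxy
  have hN0 : ∀ e, 0 ≤ N e := fun e => Finset.sum_nonneg fun W _ => hG' W
  have hNx0 : ∀ e, 0 ≤ Nx e := fun e => Finset.sum_nonneg fun W _ => mul_nonneg (hG' W) (hx0 W)
  have hNy0 : ∀ e, 0 ≤ Ny e := fun e => Finset.sum_nonneg fun W _ => mul_nonneg (hG' W) (hy0 W)
  have hNxy0 : ∀ e, 0 ≤ Nxy e :=
    fun e => Finset.sum_nonneg fun W _ => mul_nonneg (hG' W) (mul_nonneg (hx0 W) (hy0 W))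
  -- the state means
  set Xs : Finset V → R := fun e => Nx e / N e with hXs
  set Ys : Finset V → R := fun e => Ny e / N e with hYs
  have hYs0 : ∀ e, 0 ≤ Ys e := fun e => div_nonneg (hNy0 _) (hN0 _)
  have hNXs : ∀ e, N e * Xs e = Nx e := by
    intro e
    by_cases h : N e = 0
    · have hx := fiber_zero U ent e G' x hG' h
      show N e * (Nx e / N e) = Nx e
      rw [h, zero_mul]; exact hx.symm
    · show N e * (Nx e / N e) = Nx e
      field_simp
  have hNYs : ∀ e, N e * Ys e = Ny e := by
    intro e
    by_cases h : N e = 0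
    · have hy := fiber_zero U ent e G' y hG' h
      show N e * (Ny e / N e) = Ny e
      rw [h, zero_mul]; exact hy.symm
    · show N e * (Ny e / N e) = Ny e
      field_simp
  -- the state `y`-means are increasing on the support
  have hYs_mono : ∀ e e', e ⊆ e' → N e ≠ 0 → N e' ≠ 0 → Ys e ≤ Ys e' := by
    intro e e' hee hNe hNe'
    have hpe : 0 < N e := lt_of_le_of_ne (hN0 e) (Ne.symm hNe)
    have hpe' : 0 < N e' := lt_of_le_of_ne (hN0 e') (Ne.symm hNe')
    have key : Ny e * N e' ≤ N e * Ny e' := fiber_holley U ent e e' G' y hG' hy0 hym wMM hee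
    show Ny e / N e ≤ Ny e' / N e'
    rw [div_le_div_iff₀ hpe hpe']
    linarith [key]
  -- joins of an entered cluster of the gate support with a cluster of the `R`-support
  have hjoin' : ∀ s ⊆ U, ∀ t ⊆ U, (∃ r ∈ ent, r ∈ s) → G' s ≠ 0 → G t ≠ 0 →
      G' (s ∪ t) ≠ 0 := by
    intro s hs t ht hent hs0 ht0 hu
    have h1 : 0 < G' s * G t :=
      mul_pos (lt_of_le_of_ne (hG' s) (Ne.symm hs0)) (lt_of_le_of_ne (hG t) (Ne.symm ht0))
    have h2 := wML s hs t ht hent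
    rw [hu, mul_zero] at h2
    exact absurd (lt_of_lt_of_le h1 h2) (lt_irrefl 0)
  have hNpos : ∀ s ⊆ U, G' s ≠ 0 → N (s ∩ ent) ≠ 0 := by
    intro s hs hs0 hz
    have h1 : 0 < G' s := lt_of_le_of_ne (hG' s) (Ne.symm hs0)
    have h2 : G' s ≤ N (s ∩ ent) :=
      Finset.single_le_sum (f := G') (fun W _ => hG' W)
        (Finset.mem_filter.mpr ⟨Finset.mem_powerset.mpr hs, rfl⟩)
    rw [hz] at h2
    exact absurd (lt_of_lt_of_le h1 h2) (lt_irrefl 0)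
  -- the ideal-state mean is below every supported state mean
  have hYsI : ∀ e, N e ≠ 0 → Ys ∅ ≤ Ys e := by
    intro e he0
    by_cases h : N ∅ = 0
    · simp only [hYs]; rw [h, div_zero]; exact hYs0 e
    · exact hYs_mono ∅ e (Finset.empty_subset _) h he0
  -- THE LAYER CAKE over the `y`-shift relative to the ideal state
  set c : Finset V → R := fun e => N e * (Λ * Xs e - Λ₁) with hc
  set w : Finset V → R := fun e => Λ * Ys e - Λ * Ys ∅ with hw
  have hw0 : w ∅ = 0 := by simp only [hw]; ring
  have hlevelx : ∀ t : R, w ∅ < t →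
      (∑ e ∈ ent.powerset.filter (fun e => t ≤ w e), N e * (Λ * Xs e - Λ₁)) =
        Λ * (∑ W ∈ U.powerset.filter (fun W => t ≤ w (W ∩ ent)), G' W * x W) -
          Λ₁ * (∑ W ∈ U.powerset.filter (fun W => t ≤ w (W ∩ ent)), G' W) :=
    fun t ht => level_sum_eq U ent G' x hG' N w t Λ Λ₁ ht (fun e _ => rfl)
  have hlev : ∀ t : R, (0 : R) < t →
      0 ≤ ∑ e ∈ ent.powerset.filter (fun e => t ≤ w e), c e := by
    intro t ht
    have ht' : w ∅ < t := by rw [hw0]; exact ht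
    show 0 ≤ ∑ e ∈ ent.powerset.filter (fun e => t ≤ w e), N e * (Λ * Xs e - Λ₁)
    rw [hlevelx t ht']
    have hP : ∀ s ⊆ U, ∀ t' ⊆ U, t ≤ w (s ∩ ent) → G' s ≠ 0 → G t' ≠ 0 →
        t ≤ w ((s ∪ t') ∩ ent) ∧ (∃ r ∈ ent, r ∈ s) := by
      intro s hs t' ht' hPs hs0 ht'0
      have hent : ∃ r ∈ ent, r ∈ s := by
        by_contra hno
        have hse : s ∩ ent = ∅ := by
          rw [Finset.eq_empty_iff_forall_notMem]
          intro r hr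
          rw [Finset.mem_inter] at hr
          exact hno ⟨r, hr.2, hr.1⟩
        rw [hse, hw0] at hPs
        linarith
      refine ⟨?_, hent⟩
      have hu0 := hjoin' s hs t' ht' hent hs0 ht'0
      have hNs := hNpos s hs hs0
      have hNu := hNpos (s ∪ t') (Finset.union_subset hs ht') hu0
      have hee : s ∩ ent ⊆ (s ∪ t') ∩ ent :=
        Finset.inter_subset_inter Finset.subset_union_left (Finset.Subset.refl _)
      have hmono := hYs_mono (s ∩ ent) ((s ∪ t') ∩ ent) hee hNs hNu
      have := mul_le_mul_of_nonneg_left hmono hΛ0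
      simp only [hw] at hPs ⊢
      linarith
    have key := level_holley U ent G G' x hG hG' hx0 hxm wML
      (fun W => t ≤ w (W ∩ ent)) hP
    rw [← hΛ, ← hΛ₁] at key
    linarith [key]
  have hwsupp : ∀ e ∈ ent.powerset, c e ≠ 0 → (0 : R) ≤ w e := by
    intro e _ hce
    have hNe : N e ≠ 0 := by
      intro hz; apply hce; simp only [hc]; rw [hz, zero_mul]
    have := mul_le_mul_of_nonneg_left (hYsI e hNe) hΛ0
    simp only [hw]; linarith
  have hcake : 0 ≤ ∑ e ∈ ent.powerset, c e * w e :=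
    sum_mul_nonneg_of_levels ent.powerset c w 0 hwsupp (by simp) hlev
  -- the identity splitting the `y`-shift
  have hsplit : (∑ e ∈ ent.powerset, N e * (Λ * Xs e - Λ₁) * (Λ * Ys e - Λ₂)) =
      (∑ e ∈ ent.powerset, c e * w e) +
        (Λ * Ys ∅ - Λ₂) * (∑ e ∈ ent.powerset, N e * (Λ * Xs e - Λ₁)) := by
    rw [Finset.mul_sum, ← Finset.sum_add_distrib]
    refine Finset.sum_congr rfl fun e _ => ?_
    simp only [hc, hw]; ring
  -- the total `x`-shift of the gate is minus that of the killed law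
  have hK : (∑ e ∈ ent.powerset, N e * (Λ * Xs e - Λ₁)) =
      - ∑ W ∈ U.powerset, (G W - G' W) * (Λ * x W - Λ₁) := by
    have h1 : (∑ e ∈ ent.powerset, N e * (Λ * Xs e - Λ₁)) =
        ∑ e ∈ ent.powerset, (Λ * Nx e - Λ₁ * N e) := by
      refine Finset.sum_congr rfl fun e _ => ?_
      rw [← hNXs e]; ring
    have hmaps : ∀ W ∈ U.powerset, (fun W => W ∩ ent) W ∈ ent.powerset :=
      fun W _ => Finset.mem_powerset.mpr Finset.inter_subset_right
    have h2 : (∑ e ∈ ent.powerset, Nx e) = ∑ W ∈ U.powerset, G' W * x W := by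
      simp only [hNx]; exact Finset.sum_fiberwise_of_maps_to hmaps _
    have h3 : (∑ e ∈ ent.powerset, N e) = ∑ W ∈ U.powerset, G' W := by
      simp only [hN]; exact Finset.sum_fiberwise_of_maps_to hmaps _
    have h4 : (∑ W ∈ U.powerset, (G W - G' W) * (Λ * x W - Λ₁)) =
        (∑ W ∈ U.powerset, G W * (Λ * x W - Λ₁)) -
          (Λ * (∑ W ∈ U.powerset, G' W * x W) - Λ₁ * (∑ W ∈ U.powerset, G' W)) := by
      rw [Finset.mul_sum, Finset.mul_sum, ← Finset.sum_sub_distrib, ← Finset.sum_sub_distrib]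
      exact Finset.sum_congr rfl fun W _ => by ring
    rw [h1, Finset.sum_sub_distrib, ← Finset.mul_sum, ← Finset.mul_sum, h2, h3, h4, hcentred]
    ring
  -- each state's term is dominated by its cluster sum (within-state FKG)
  set T : Finset V → R := fun e => ∑ W ∈ U.powerset.filter (fun W => W ∩ ent = e),
    G' W * ((Λ * x W - Λ₁) * (Λ * y W - Λ₂)) with hT
  have hstate : ∀ e, N e * (Λ * Xs e - Λ₁) * (Λ * Ys e - Λ₂) ≤ T e := by
    intro e
    have hTe : T e = Λ * Λ * Nxy e - Λ * Λ₂ * Nx e - Λ * Λ₁ * Ny e + Λ₁ * Λ₂ * N e := by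
      show (∑ W ∈ U.powerset.filter (fun W => W ∩ ent = e),
        G' W * ((Λ * x W - Λ₁) * (Λ * y W - Λ₂))) = _
      rw [centred_expand_sc]
    have hcov : N e * (Xs e * Ys e) ≤ Nxy e := by
      by_cases h : N e = 0
      · rw [h, zero_mul]; exact hNxy0 e
      · have hpos : 0 < N e := lt_of_le_of_ne (hN0 e) (Ne.symm h)
        have key : Nx e * Ny e ≤ N e * Nxy e := fiber_cov U ent e G' x y hG' hx0 hy0 hxm hym wMM
        show N e * (Nx e / N e * (Ny e / N e)) ≤ Nxy e
        rw [div_mul_div_comm, mul_div_assoc', div_le_iff₀ (mul_pos hpos hpos)]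
        calc N e * (Nx e * Ny e) ≤ N e * (N e * Nxy e) := mul_le_mul_of_nonneg_left key hpos.le
          _ = Nxy e * (N e * N e) := by ring
    have e5 : N e * (Λ * Xs e - Λ₁) * (Λ * Ys e - Λ₂) =
        Λ * Λ * (N e * (Xs e * Ys e)) - Λ * Λ₂ * (N e * Xs e) - Λ * Λ₁ * (N e * Ys e)
          + Λ₁ * Λ₂ * N e := by ring
    rw [e5, hNXs e, hNYs e, hTe]
    have := mul_le_mul_of_nonneg_left hcov (mul_nonneg hΛ0 hΛ0)
    linarith
  have hsumT : (∑ e ∈ ent.powerset, T e) = ∑ W ∈ U.powerset,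
      G' W * ((Λ * x W - Λ₁) * (Λ * y W - Λ₂)) := by
    have hmaps : ∀ W ∈ U.powerset, (fun W => W ∩ ent) W ∈ ent.powerset :=
      fun W _ => Finset.mem_powerset.mpr Finset.inter_subset_right
    simp only [hT]
    exact Finset.sum_fiberwise_of_maps_to hmaps _
  have hsum : (∑ e ∈ ent.powerset, N e * (Λ * Xs e - Λ₁) * (Λ * Ys e - Λ₂)) ≤
      ∑ W ∈ U.powerset, G' W * ((Λ * x W - Λ₁) * (Λ * y W - Λ₂)) := by
    rw [← hsumT]
    exact Finset.sum_le_sum fun e _ => hstate e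
  -- assemble
  have hmain : (Λ * Ys ∅ - Λ₂) * (∑ e ∈ ent.powerset, N e * (Λ * Xs e - Λ₁)) ≤
      ∑ W ∈ U.powerset, G' W * ((Λ * x W - Λ₁) * (Λ * y W - Λ₂)) := by
    linarith [hsplit, hcake, hsum]
  have hNI : N ∅ = ∑ W ∈ U.powerset.filter (fun W => W ∩ ent = ∅), G' W := rfl
  have hNyI : Ny ∅ = ∑ W ∈ U.powerset.filter (fun W => W ∩ ent = ∅), G' W * y W := rfl
  have hNe0 : 0 ≤ N ∅ := hN0 ∅
  have hfin := mul_le_mul_of_nonneg_left hmain hNe0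
  rw [← hNI, ← hNyI]
  have e6 : N ∅ * ((Λ * Ys ∅ - Λ₂) * (∑ e ∈ ent.powerset, N e * (Λ * Xs e - Λ₁))) =
      (Λ₂ * N ∅ - Λ * Ny ∅) * (∑ W ∈ U.powerset, (G W - G' W) * (Λ * x W - Λ₁)) := by
    rw [hK]
    have := hNYs ∅
    calc N ∅ * ((Λ * Ys ∅ - Λ₂) * -(∑ W ∈ U.powerset, (G W - G' W) * (Λ * x W - Λ₁)))
        = (Λ * (N ∅ * Ys ∅) - Λ₂ * N ∅) *
            -(∑ W ∈ U.powerset, (G W - G' W) * (Λ * x W - Λ₁)) := by ring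
      _ = _ := by rw [this]; ring
  rw [e6] at hfin
  exact hfin

end TauLayer

end Summit.Ventures.PercRepro2.Coin
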